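import Summits.Ventures.LatticeQCDFlow.Scaling.HomStarExchangeableLaw
import Literature.Probability.MarkovChains.ExpanderMixingTime
import Literature.Probability.MarkovChains.SpectralGapVariational

/-!
HONEST FRAMING: exact (Metropolis-corrected) sampling algorithms for lattice gauge theory; figures
of merit are autocorrelation/cost numbers at stated couplings and volumes; no continuum-physics
claim.

# HomStarPathLumping — THE LUMPING AT THE LEVEL OF PATHS, AND THE `q`-LAZY TOOLKIT: `E_y[F(ΛX_1,…,ΛX_n)]` UNDER THE HOMOGENEOUS SCHEME IS `E_{Λy}[F]` UNDER THE LAZY LUMPED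
# CHAIN `S_l`; `S' = qS + (1−q)I` IS ROW-STOCHASTIC, REVERSIBLE, IRREDUCIBLE WITH `S` (`S'ⁿ ≥ qⁿSⁿ`), AND `γ(S') = q·γ(S)` (lean-2 GEN-44, ours)

Venture-side (OURS).  Cell `lqcd-flow` (pub-lqcd), unit `pub-lqcd-lean-2-g44`, 2026-08-31.  Chapter AD, file 13 — the tools that carry PATH functionals (time averages) of pooled
observables from chapter U's scheme to the lazy lumped chain: §1 the generic `q`-lazy facts (row sums, detailed balance, `S'ⁿ(x,y) ≥ qⁿSⁿ(x,y)` hence irreducibility, the Dirichlet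
form scales by `q` so `Gap_R(S') = q·Gap_R(S)` and `γ(S') = q·γ(S)` by LPW Lemma 13.7 — the tree's `lazyVersion` lemmas verbatim with `½ ↦ q`); §2 `homStar_pushforward_pathSum`:
`pathSum P n y (F ∘ (Λ∘·)) = pathSum S_l n (Λy) F` by the fibre sums of file 8 (Dynkin lumpability: `(ΛX_k)_k` is a Markov chain with kernel `S_l`).

* `lazyq_isRowStochastic`, `lazyq_detailedBalance`, `lazyq_pow_ge`, `lazyq_isIrreducible`, `dirichletForm_lazyq`, `spectralGapR_lazyq`, `spectralGap_lazyq`; **`homStar_pushforward_pathSum`**.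

Literature grade (cell rule): OWN, elementary on the tree's LPW files; nothing cited; no new bib keys.
-/

noncomputable section
open Finset Function
open Literature.Probability.MarkovChains

namespace Summit.Ventures.LatticeQCDFlow.Scaling

/-! ## §1 The `q`-lazy toolkit -/

section LazyQ
variable {X : Type*} [Fintype X] [DecidableEq X] {S S' : Matrix X X ℝ} {q : ℝ}

/-- `S' = qS + (1−q)I` is a transition matrix (`0 ≤ q ≤ 1`). [ours] -/
theorem lazyq_isRowStochastic (hS : IsRowStochastic S) (hq0 : 0 ≤ q) (hq1 : q ≤ 1)
    (hS' : ∀ x y, S' x y = q * S x y + (1 - q) * (if x = y then 1 else 0)) : IsRowStochastic S' := by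
  refine ⟨fun x y => by rw [hS']; exact add_nonneg (mul_nonneg hq0 (hS.1 x y)) (mul_nonneg (by linarith) (by split_ifs <;> norm_num)), fun x => ?_⟩
  simp_rw [hS']
  rw [sum_add_distrib, ← mul_sum, hS.2 x, ← mul_sum, Finset.sum_ite_eq univ x, if_pos (mem_univ _)]; ring

omit [Fintype X] in
/-- `S'` is reversible with `S`. [ours] -/
theorem lazyq_detailedBalance {π : X → ℝ} (hDB : DetailedBalance π S)
    (hS' : ∀ x y, S' x y = q * S x y + (1 - q) * (if x = y then 1 else 0)) : DetailedBalance π S' := by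
  intro x y
  rw [hS', hS']
  by_cases hxy : x = y
  · subst hxy; rfl
  · rw [if_neg hxy, if_neg (Ne.symm hxy)]; have := hDB x y; linear_combination q * this

/-- `S'ⁿ(x,y) ≥ qⁿSⁿ(x,y)` (`0 ≤ q ≤ 1`). [ours] -/
theorem lazyq_pow_ge (hS0 : ∀ x y, 0 ≤ S x y) (hq0 : 0 ≤ q) (hq1 : q ≤ 1)
    (hS' : ∀ x y, S' x y = q * S x y + (1 - q) * (if x = y then 1 else 0)) :
    ∀ (n : ℕ) (x y : X), q ^ n * (S ^ n) x y ≤ (S' ^ n) x y := by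
  have hS'0 : ∀ x y, 0 ≤ S' x y := fun x y => by rw [hS']; exact add_nonneg (mul_nonneg hq0 (hS0 x y)) (mul_nonneg (by linarith) (by split_ifs <;> norm_num))
  have hge : ∀ x y, q * S x y ≤ S' x y := fun x y => by rw [hS']; nlinarith [show (0:ℝ) ≤ (if x = y then (1:ℝ) else 0) by split_ifs <;> norm_num]
  have hpow0 : ∀ (n : ℕ) (x y : X), 0 ≤ (S' ^ n) x y := by
    intro n; induction n with
    | zero => intro x y; rw [pow_zero, Matrix.one_apply]; split_ifs <;> norm_num
    | succ n ih => intro x y; rw [pow_succ, Matrix.mul_apply]; exact sum_nonneg fun z _ => mul_nonneg (ih x z) (hS'0 z y)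
  have hpowS0 : ∀ (n : ℕ) (x y : X), 0 ≤ (S ^ n) x y := by
    intro n; induction n with
    | zero => intro x y; rw [pow_zero, Matrix.one_apply]; split_ifs <;> norm_num
    | succ n ih => intro x y; rw [pow_succ, Matrix.mul_apply]; exact sum_nonneg fun z _ => mul_nonneg (ih x z) (hS0 z y)
  intro n
  induction n with
  | zero => intro x y; rw [pow_zero, pow_zero, pow_zero, one_mul]
  | succ n ih =>
    intro x y
    rw [pow_succ, pow_succ, pow_succ, Matrix.mul_apply, Matrix.mul_apply, mul_sum]
    refine sum_le_sum fun z _ => ?_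
    calc q ^ n * q * ((S ^ n) x z * S z y) = (q ^ n * (S ^ n) x z) * (q * S z y) := by ring
      _ ≤ (S' ^ n) x z * S' z y := mul_le_mul (ih x z) (hge z y) (mul_nonneg hq0 (hS0 z y)) (hpow0 n x z)

/-- Irreducibility passes to `S'` (`0 < q ≤ 1`). [ours] -/
theorem lazyq_isIrreducible (hS0 : ∀ x y, 0 ≤ S x y) (hq0 : 0 < q) (hq1 : q ≤ 1)
    (hS' : ∀ x y, S' x y = q * S x y + (1 - q) * (if x = y then 1 else 0)) (hirr : Literature.Probability.MarkovChains.IsIrreducible S) : Literature.Probability.MarkovChains.IsIrreducible S' := by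
  intro x y
  obtain ⟨n, hn⟩ := hirr x y
  exact ⟨n, lt_of_lt_of_le (mul_pos (pow_pos hq0 n) hn) (lazyq_pow_ge hS0 hq0.le hq1 hS' n x y)⟩

/-- `𝓔_{S'}(f) = q·𝓔_S(f)`. [ours] -/
theorem dirichletForm_lazyq (π : X → ℝ) (hS' : ∀ x y, S' x y = q * S x y + (1 - q) * (if x = y then 1 else 0)) (f : X → ℝ) :
    dirichletForm π S' f = q * dirichletForm π S f := by
  unfold dirichletForm
  have h : ∀ x y, π x * S' x y * (f x - f y) ^ 2 = q * (π x * S x y * (f x - f y) ^ 2) := by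
    intro x y
    by_cases hxy : x = y
    · subst hxy; simp
    · rw [hS', if_neg hxy]; ring
  simp_rw [h, ← mul_sum]
  ring

/-- `Gap_R(S') = q·Gap_R(S)` (reversible `S`, positive `π`, `|X| ≥ 2`, `0 ≤ q ≤ 1`). [ours] -/
theorem spectralGapR_lazyq [Nontrivial X] {π : X → ℝ} (hπ : ∀ x, 0 < π x) (hπ1 : ∑ x, π x = 1)
    (hS : IsRowStochastic S) (hDB : DetailedBalance π S) (hq0 : 0 ≤ q) (hq1 : q ≤ 1)
    (hS' : ∀ x y, S' x y = q * S x y + (1 - q) * (if x = y then 1 else 0)) :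
    spectralGapR π S' = q * spectralGapR π S := by
  have hπ0 : ∀ x, 0 ≤ π x := fun x => (hπ x).le
  have hSL := lazyq_isRowStochastic hS hq0 hq1 hS'
  have hDBL := lazyq_detailedBalance hDB hS'
  obtain ⟨g, hg0, hg1, hgE, -⟩ := exists_eigenfunction_spectralGapR hπ hπ1 hS hDB
  obtain ⟨g', hg0', hg1', hgE', -⟩ := exists_eigenfunction_spectralGapR hπ hπ1 hSL hDBL
  refine le_antisymm ?_ ?_
  · calc spectralGapR π S' ≤ dirichletForm π S' g := spectralGapR_le_dirichletForm hπ0 hSL.1 hg0 hg1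
      _ = q * dirichletForm π S g := dirichletForm_lazyq π hS' g
      _ = q * spectralGapR π S := by rw [hgE]
  · have h1 : spectralGapR π S ≤ dirichletForm π S g' := spectralGapR_le_dirichletForm hπ0 hS.1 hg0' hg1'
    have h2 : dirichletForm π S' g' = q * dirichletForm π S g' := dirichletForm_lazyq π hS' g'
    rw [← hgE', h2]
    exact mul_le_mul_of_nonneg_left h1 hq0

/-- **`γ(S') = q·γ(S)`.** [ours] -/
theorem spectralGap_lazyq [Nontrivial X] {π : X → ℝ} (hπ : ∀ x, 0 < π x) (hπ1 : ∑ x, π x = 1)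
    (hS : IsRowStochastic S) (hDB : DetailedBalance π S) (hq0 : 0 ≤ q) (hq1 : q ≤ 1)
    (hS' : ∀ x y, S' x y = q * S x y + (1 - q) * (if x = y then 1 else 0)) :
    spectralGap π S' = q * spectralGap π S := by
  rw [LevinPeres2017_lemma_13_7 hπ hπ1 (lazyq_isRowStochastic hS hq0 hq1 hS') (lazyq_detailedBalance hDB hS'),
    LevinPeres2017_lemma_13_7 hπ hπ1 hS hDB, spectralGapR_lazyq hπ hπ1 hS hDB hq0 hq1 hS']

end LazyQ

/-! ## §2 Path functionals lump -/

section PathLump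
variable {S : Type*} [Fintype S] [DecidableEq S] {K m : ℕ} {μ : Fin (K + 1) → S → ℝ} {M : Fin (K + 1) → S → S → ℝ} {w : Fin (K + 1) → ℝ} {t : ℝ}
variable (κ : Fin m → Fin K)
variable {X : Type*} [Fintype X] [DecidableEq X] {hub : X → S} {comp : X → S → ℕ} {acc : S → S → ℝ} {Kh : (S → ℕ) → S → S → ℝ} {Ast Bst Sl : X → X → ℝ}
variable {Λ : (Fin (K + 1) → S) → X}

omit [Fintype X] in
/-- **PATH FUNCTIONALS OF THE LUMPED PROCESS:** `pathSum P n y (F ∘ (Λ ∘ ·)) = pathSum S_l n (Λy) F`. [ours] -/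
theorem homStar_pushforward_pathSum [Fintype X] (hm : 1 ≤ m) (hμ : ∀ k x, 0 < μ k x) (hhom : ∀ i : Fin K, μ i.succ = μ 1) (hw1 : ∑ k, w k = 1)
    (hM0 : ∀ u v, M 0 u v = μ 0 v) (hidle : ∀ i : Fin K, ∀ u v, M i.succ u v = if v = u then 1 else 0)
    {c : ℕ} (hunif : ∀ i : Fin K, (univ.filter fun r : Fin m => κ r = i).card = c)
    (hacc : ∀ u v, acc u v = min 1 (μ 0 v * μ 1 u / (μ 0 u * μ 1 v)))
    (hKoff : ∀ N h v, h ≠ v → Kh N h v = if N h = 0 then 0 else (N v : ℝ) / K * acc h v) (hKdiag : ∀ N h, Kh N h h = 1 - ∑ v ∈ univ.erase h, Kh N h v)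
    (hA : ∀ x x', Ast x x' = if comp x' = comp x then Kh (comp x) (hub x) (hub x') else 0)
    (hB : ∀ x x', Bst x x' = μ 0 (hub x') * (if comp x' + Pi.single (hub x) 1 = comp x + Pi.single (hub x') 1 then 1 else 0))
    (hSl : ∀ x x', Sl x x' = t * Ast x x' + (1 - t) * (w 0 * Bst x x' + (1 - w 0) * (if x = x' then 1 else 0)))
    (hΛh : ∀ y, hub (Λ y) = y 0) (hΛc : ∀ y v, comp (Λ y) v = (univ.filter fun k : Fin (K + 1) => y k = v).card)
    (hinj : ∀ x x', hub x = hub x' → comp x = comp x' → x = x') (n : ℕ) :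
    ∀ (y : Fin (K + 1) → S) (F : (Fin n → X) → ℝ),
      pathSum (Matrix.of fun a b => t * ptGraphSwap μ (fun r : Fin m => (((0 : Fin (K + 1)), (κ r).succ) : Fin (K + 1) × Fin (K + 1))) (fun _ : Fin m => Equiv.refl S) a b
          + (1 - t) * prodKernel w M a b) n y (fun ω => F (fun i => Λ (ω i)))
        = pathSum (Matrix.of fun a b => Sl a b) n (Λ y) F := by
  classical
  induction n with
  | zero =>
    intro y F
    show F _ = F _
    congr 1; funext i; exact Fin.elim0 i
  | succ n ih =>
    intro y F
    rw [pathSum_succ, pathSum_succ]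
    -- regroup the first step by the image of the next configuration
    have hfib := homStar_fibre_step (t := t) κ hm hμ hhom hw1 hM0 hidle hunif hacc hKoff hKdiag hA hB hΛh hΛc hinj y
    simp only [Matrix.of_apply]
    have hstep : ∀ z, pathSum (Matrix.of fun a b => t * ptGraphSwap μ (fun r : Fin m => (((0 : Fin (K + 1)), (κ r).succ) : Fin (K + 1) × Fin (K + 1)))
        (fun _ : Fin m => Equiv.refl S) a b + (1 - t) * prodKernel w M a b) n z (fun ω => F (Matrix.vecCons (Λ z) (fun i => Λ (ω i))))
        = pathSum (Matrix.of fun a b => Sl a b) n (Λ z) (fun ω => F (Matrix.vecCons (Λ z) ω)) := fun z => ih z (fun ω => F (Matrix.vecCons (Λ z) ω))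
    have hrew : ∀ z, (fun ω : Fin n → Fin (K + 1) → S => F (fun i => Λ (Matrix.vecCons z ω i))) = fun ω => F (Matrix.vecCons (Λ z) (fun i => Λ (ω i))) := by
      intro z; funext ω; congr 1; funext i; refine Fin.cases ?_ (fun j => ?_) i <;> simp
    simp_rw [hrew, hstep]
    rw [← Finset.sum_fiberwise univ Λ (fun z => (t * ptGraphSwap μ (fun r : Fin m => (((0 : Fin (K + 1)), (κ r).succ) : Fin (K + 1) × Fin (K + 1)))
        (fun _ : Fin m => Equiv.refl S) y z + (1 - t) * prodKernel w M y z) * pathSum (Matrix.of fun a b => Sl a b) n (Λ z) (fun ω => F (Matrix.vecCons (Λ z) ω)))]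
    refine sum_congr rfl fun x' _ => ?_
    rw [show (∑ z ∈ univ.filter (fun z => Λ z = x'), (t * ptGraphSwap μ (fun r : Fin m => (((0 : Fin (K + 1)), (κ r).succ) : Fin (K + 1) × Fin (K + 1)))
        (fun _ : Fin m => Equiv.refl S) y z + (1 - t) * prodKernel w M y z) * pathSum (Matrix.of fun a b => Sl a b) n (Λ z) (fun ω => F (Matrix.vecCons (Λ z) ω)))
        = (∑ z ∈ univ.filter (fun z => Λ z = x'), (t * ptGraphSwap μ (fun r : Fin m => (((0 : Fin (K + 1)), (κ r).succ) : Fin (K + 1) × Fin (K + 1)))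
        (fun _ : Fin m => Equiv.refl S) y z + (1 - t) * prodKernel w M y z)) * pathSum (Matrix.of fun a b => Sl a b) n x' (fun ω => F (Matrix.vecCons x' ω)) from by
      rw [sum_mul]; exact sum_congr rfl fun z hz => by rw [(mem_filter.mp hz).2]]
    rw [hfib x', hSl (Λ y) x']

end PathLump

end Summit.Ventures.LatticeQCDFlow.Scaling

end
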